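import Summits.AtomisticToContinuum.HydrodynamicLimit.Theorems.DensityCap.Negative.MollifiedDensity

/-!
# `DensityCap`: the `t = 0` tie and the Euler balance laws are load-bearing

Negative knowledge for the crux `JParityClosure.DensityCap` (stmt-AtomisticToContinuum-13082), from the standing
disprover's `Cruxes/DensityCap/Disproof.lean` §3 (cycle 1). Two variants of the crux with ONE hypothesis dropped are
FALSE, so every proof of the crux must use that hypothesis:
* `densityCap_false_untied : ¬ DensityCapUntied` — the `t = 0` tie `TendstoHydroFieldsAt … 0` dropped (the Euler
  solution is then not the one issued from the data): witness the UNTIED constant state `(1/100, 0, 1)` under the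
  homogeneous local Gibbs law; some centre always carries mollified density `≥ 3/(16π) > 1/50`
  (`DensityCapNegative.exists_le_mollDensity`), so the overshoot event is sure.
* `densityCap_false_noPDE : ¬ DensityCapNoPDE` — the three balance laws of `IsHardSphereEulerSolution` dropped, joint
  smoothness, positivity AND the tie kept: witness the tied smooth positive fields `(e^{-40s}, 0, 1)`, violated at
  `s = 1/2` (`e^{-20} ≤ 1/121`).
The content of the crux is therefore: the density TRANSPORTED BY THE CONTINUITY EQUATION from the PINNED data dominates
the particle density (mass conservation `∫ρ(s,·) = 1 =` empirical mass is the first thing a proof consumes).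
refuter-cdisprove-stmt-AtomisticToContinuum-13082-0.
-/

noncomputable section

namespace Summit.AtomisticToContinuum.HydrodynamicLimit.Theorems.DensityCapNegative

open MeasureTheory Filter Set Topology
open scoped ENNReal
open Literature.MathematicalPhysics.KineticTheory Literature.Analysis.FluidPDE
open Literature.Analysis.FunctionSpaces
open Summit.AtomisticToContinuum.HydrodynamicLimit.Theses.JParityClosure
open Summit.AtomisticToContinuum.HydrodynamicLimit.Theorems.PolynomialCompressionPDE (Flows flows_nonempty)

/-! ## §3 Load-bearing hypotheses: the `t = 0` tie and the Euler balance laws -/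

/-- `DensityCap` WITHOUT THE `t = 0` TIE (`TendstoHydroFieldsAt … 0` dropped; everything else verbatim): the
Euler solution is then not the one issued from the data. -/
def DensityCapUntied : Prop :=
  ∀ (a₀ θ₀ : T3 → ℝ) (u₀ : T3 → V3), Continuous a₀ → Continuous θ₀ → Continuous u₀ →
    (∀ x, 0 < a₀ x) → (∀ x, 0 < θ₀ x) → ∃ σ₀ : ℝ, 0 < σ₀ ∧ ∀ σ : ℝ, 0 < σ → σ < σ₀ →
    ∀ (T : ℝ) (ρ θ : ℝ → T3 → ℝ) (u : ℝ → T3 → V3), IsHardSphereEulerSolution σ T ρ u θ →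
    ∀ Φ : Flows σ, ∀ t ∈ Ico 0 T, CapLimit σ a₀ u₀ θ₀ Φ ρ t

/-- **The `t = 0` tie is load-bearing**: `¬ DensityCapUntied`. Witness: homogeneous profiles `(1, 1, 0)`, the
UNTIED constant Euler state `(1/100, 0, 1)` on `[0, 1)`, Alexander's flows, `t = 0`, `η = 1/100`, `δ = 1/2`: for
every `r ≤ 1` and every `N` the overshoot event is the whole phase space (some centre carries mollified density
`≥ 3/(16π) > 1/50`, `exists_le_mollDensity`), of local Gibbs probability `1 > 1/2`. Any proof of the crux must use
the tie — at least to fix `∫ρ(0,·) = 1 = ` the empirical mass. -/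
theorem densityCap_false_untied : ¬ DensityCapUntied := by
  intro h
  obtain ⟨σ₁, hσ₁, hσ₁2, H1⟩ := homogeneous_lln
  obtain ⟨σ₀, hσ₀, h⟩ := h (fun _ => 1) (fun _ => 1) (fun _ => 0) continuous_const continuous_const
    continuous_const (fun _ => one_pos) (fun _ => one_pos)
  obtain ⟨σ, hσ, hσ0, hσ1, hσ2⟩ := exists_sigma hσ₀ hσ₁ hσ₁2
  obtain ⟨Φ⟩ := flows_nonempty hσ hσ2
  obtain ⟨hprob, -⟩ := H1 σ hσ hσ1 Φ
  have hsol := constState_isSolution σ 1 (c := 1 / 100) (θc := 1) (by norm_num) one_pos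
  obtain ⟨r₀, hr₀, hr⟩ := h σ hσ hσ0 1 _ _ _ hsol Φ 0 ⟨le_rfl, one_pos⟩ (1 / 100) (1 / 2)
    (by norm_num) (by norm_num)
  set r : ℝ := min (r₀ / 2) 1 with hrdef
  have hrpos : 0 < r := lt_min (by linarith) one_pos
  have hrlt : r < r₀ := lt_of_le_of_lt (min_le_left _ _) (by linarith)
  have hr1 : r ≤ 1 := min_le_right _ _
  obtain ⟨N₀, hN⟩ := hr r hrpos hrlt
  haveI := hprob N₀
  refine not_univ_le _ (by norm_num : (1 : ℝ) / 2 < 1) (Set.eq_univ_of_forall fun z => ?_) (hN N₀ le_rfl)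
  obtain ⟨x₀, hx₀⟩ := exists_le_mollDensity hrpos hr1 (Nat.succ_ne_zero N₀) ((Φ N₀).flow 0 z)
  refine ⟨0, ⟨le_rfl, le_rfl⟩, x₀, ?_⟩
  have hπ : 3 / (16 * 4) ≤ 3 / (16 * Real.pi) := by
    gcongr
    exact Real.pi_le_four
  show (1 : ℝ) / 100 + 1 / 100 < mollDensity r ((Φ N₀).flow 0 z) x₀
  linarith

/-- `DensityCap` WITHOUT THE EULER BALANCE LAWS (joint smoothness, positivity and the `t = 0` tie kept; the three
conservation laws of `IsHardSphereEulerSolution` dropped). -/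
def DensityCapNoPDE : Prop :=
  ∀ (a₀ θ₀ : T3 → ℝ) (u₀ : T3 → V3), Continuous a₀ → Continuous θ₀ → Continuous u₀ →
    (∀ x, 0 < a₀ x) → (∀ x, 0 < θ₀ x) → ∃ σ₀ : ℝ, 0 < σ₀ ∧ ∀ σ : ℝ, 0 < σ → σ < σ₀ →
    ∀ (T : ℝ) (ρ θ : ℝ → T3 → ℝ) (u : ℝ → T3 → V3),
    Torus.IsSmoothSpaceTimeOn (Ico 0 T) ρ → Torus.IsSmoothSpaceTimeOn (Ico 0 T) u →
    Torus.IsSmoothSpaceTimeOn (Ico 0 T) θ → (∀ t ∈ Ico 0 T, ∀ x, 0 < ρ t x) →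
    (∀ t ∈ Ico 0 T, ∀ x, 0 < θ t x) →
    ∀ Φ : Flows σ, TendstoHydroFieldsAt (fun N => localGibbsLaw σ a₀ u₀ θ₀ N (Φ N)) Φ ρ u θ 0 →
    ∀ t ∈ Ico 0 T, CapLimit σ a₀ u₀ θ₀ Φ ρ t

/-- **The balance laws are load-bearing**: `¬ DensityCapNoPDE`. Witness: homogeneous profiles, the smooth positive
TIED fields `(e^{-40s}, 0, 1)` on `[0, 1)` (not a solution: mass is not conserved), `t = 1/2`, `η = 1/100`,
`δ = 1/2`: at `s = 1/2` the "density" is `e^{-20} ≤ 1/121` while some centre carries mollified density `≥ 3/(16π)`,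
so the overshoot event is sure. The cap is a statement about the density TRANSPORTED by the continuity equation
from the pinned data, not about smooth positive fields with the right data. -/
theorem densityCap_false_noPDE : ¬ DensityCapNoPDE := by
  intro h
  obtain ⟨σ₁, hσ₁, hσ₁2, H1⟩ := homogeneous_lln
  obtain ⟨σ₀, hσ₀, h⟩ := h (fun _ => 1) (fun _ => 1) (fun _ => 0) continuous_const continuous_const
    continuous_const (fun _ => one_pos) (fun _ => one_pos)
  obtain ⟨σ, hσ, hσ0, hσ1, hσ2⟩ := exists_sigma hσ₀ hσ₁ hσ₁2
  obtain ⟨Φ⟩ := flows_nonempty hσ hσ2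
  obtain ⟨hprob, hT⟩ := H1 σ hσ hσ1 Φ
  -- the tied, smooth, positive, non-conservative fields
  set ρ : ℝ → T3 → ℝ := fun s _ => Real.exp (-(40 * s)) with hρ
  have hsmρ : Torus.IsSmoothSpaceTimeOn (Ico 0 1) ρ :=
    (by fun_prop : ContDiff ℝ _ (fun p : ℝ × EuclideanSpace ℝ (Fin 3) => Real.exp (-(40 * p.1)))).contDiffOn
  have hsmu : Torus.IsSmoothSpaceTimeOn (Ico 0 1) (fun (_ : ℝ) (_ : T3) => (0 : V3)) := contDiffOn_const
  have hsmθ : Torus.IsSmoothSpaceTimeOn (Ico 0 1) (fun (_ : ℝ) (_ : T3) => (1 : ℝ)) := contDiffOn_const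
  have hT' : TendstoHydroFieldsAt (fun N => localGibbsLaw σ (fun _ => 1) (fun _ => 0) (fun _ => 1) N (Φ N)) Φ
      ρ (fun _ _ => 0) (fun _ _ => 1) 0 := by
    rw [PolynomialCompressionPDE.tendstoHydroFieldsAt_zero_iff_flowFree] at hT ⊢
    have h0 : ρ 0 = fun _ => (1 : ℝ) := by
      funext x
      simp [hρ]
    rw [h0]
    exact hT
  obtain ⟨r₀, hr₀, hr⟩ := h σ hσ hσ0 1 ρ (fun _ _ => 1) (fun _ _ => 0) hsmρ hsmu hsmθ
    (fun _ _ _ => Real.exp_pos _) (fun _ _ _ => one_pos) Φ hT' (1 / 2) ⟨by norm_num, by norm_num⟩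
    (1 / 100) (1 / 2) (by norm_num) (by norm_num)
  set r : ℝ := min (r₀ / 2) 1 with hrdef
  have hrpos : 0 < r := lt_min (by linarith) one_pos
  have hrlt : r < r₀ := lt_of_le_of_lt (min_le_left _ _) (by linarith)
  have hr1 : r ≤ 1 := min_le_right _ _
  obtain ⟨N₀, hN⟩ := hr r hrpos hrlt
  haveI := hprob N₀
  refine not_univ_le _ (by norm_num : (1 : ℝ) / 2 < 1) (Set.eq_univ_of_forall fun z => ?_) (hN N₀ le_rfl)
  obtain ⟨x₀, hx₀⟩ := exists_le_mollDensity hrpos hr1 (Nat.succ_ne_zero N₀) ((Φ N₀).flow (1 / 2) z)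
  refine ⟨1 / 2, ⟨by norm_num, le_rfl⟩, x₀, ?_⟩
  have hπ : 3 / (16 * 4) ≤ 3 / (16 * Real.pi) := by
    gcongr
    exact Real.pi_le_four
  have he : (121 : ℝ) ≤ Real.exp 20 := by
    have h10 : (11 : ℝ) ≤ Real.exp 10 := by linarith [Real.add_one_le_exp (10 : ℝ)]
    have h20 : Real.exp 20 = Real.exp 10 * Real.exp 10 := by
      rw [← Real.exp_add]
      norm_num
    rw [h20]
    nlinarith [Real.exp_pos (10 : ℝ)]
  have hexp : Real.exp (-(40 * (1 / 2 : ℝ))) ≤ 1 / 121 := by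
    rw [show (-(40 * (1 / 2 : ℝ))) = -20 by norm_num, Real.exp_neg, ← one_div]
    exact one_div_le_one_div_of_le (by norm_num) he
  show Real.exp (-(40 * (1 / 2 : ℝ))) + 1 / 100 < mollDensity r ((Φ N₀).flow (1 / 2) z) x₀
  linarith

end Summit.AtomisticToContinuum.HydrodynamicLimit.Theorems.DensityCapNegative

end
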